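import Mathlib

/-!
# P1LatticeIndexTwoExactCore1 — D13's THEOREM A (proofs/P1-FermatLatticeClosure-v1.2.md l.4, DECLARED STATUS l.4789) at its
INDEX-2 degrees: the «EXACTLY 2» half of the clause «[H_M : L_M] = 2 and 2H_M ⊂ L_M», kernel-checked — THE CORE, PART 1 of 3: the definitions — the tables, the weights S(u, x) and the Hodge predicate, the odd vectors, the functional φ_χ and the parity, Aoki's σ_{p,i}, THE BLOCK SET `IsBlock`, the profiles and the three kernel checks (`checkP`, `check6`, `checkS`) — used by the per-degree files
(pub-hodge-repro0, p1 (g28), 2026-08-30) — the companion of lean/P1LatticeIndexTwoA–F.lean (p1 (g27), STATUS l.11237: the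
containment half 2·H_M ⊆ L_M).

Supporting artefact in the sense of ROUTE.md R-5 (finite combinatorics / exact arithmetic only; never the discharge of a
Hodge-theoretic step; record-only).  THE OBJECTS, as the D13 page defines them (§1 l.7): odd vectors s ∈ ℤ^{⌊(M−1)/2⌋}
(the coordinate a ↔ the pair {a, M − a}, 1 ≤ a ≤ ⌊(M−1)/2⌋; for M even the coordinate M/2 is taken modulo the pair
(M/2, M/2) = 2e_{M/2} ∈ L_M and is NOT a coordinate here); H_M := the integer kernel of the weight constraints
Σₐ sₐ·(2·(t·a mod M) − M) = 0, t a unit mod M; L_M := the ℤ-span of the odd vectors of the LEGITIMATE BLOCKS — here stated as a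
PREDICATE on multisets (`IsBlock`), not a listed set: every Hodge 4-multiset of ℤ/M, every Hodge 6-multiset of ℤ/M that is the
sum of two zero-sum triples, every σ_{p,i} of Aoki's full p-standard set of level M (p an odd prime dividing M, 1 ≤ i < M,
(M/p)/gcd(i, M/p) > 2 — the level-M σ's with gcd(i, M/p) = 1 and the pull-backs of those of every level m′ ∣ M); the pull-backs
and unit translates of the 4- and 6-multisets of the levels m′ ∣ M are such multisets of level M themselves, so this set
contains every block of the page's Lemma 1 (b).  Per degree M the kernel certifies (`decide +kernel`; every number from the
generator's JSON, nothing typed by hand):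
* `units_eq_M` — the listed units are `unitsL M` (the t < M with gcd(t, M) = 1);
* `checkP_M`, `check6_M`, `checkS_M` — a ℤ/2-functional χ_M (`chi_M`, on the coordinates a < M/2) has EVEN value on the odd
  vector of EVERY block: every Hodge 4-multiset through its two sorted pairs — for every sorted pair [a, b] ⊂ [1, M−1] with
  a + b ≢ 0 (mod M) the weights S(u, [a, b]) are ≢ 0 (mod M) and the table `tabP_M`, keyed by M·profile + ((a + b) mod M)
  (the profile = the bits [M < S(u, T)] over the units u < M/2), gives its parity at the key or at the complementary key
  (one of each complementary pair is stored), and the table's parities agree at complementary keys ([a, b] ∗ [c, d] with a + b ≢ 0 is Hodge iff c + d ≡ −(a + b) and the profiles are complementary, Lemma `par4`; the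
  cancelling case a + b ≡ 0 has odd vector 0, Lemma `oddVec_cancel`); every split Hodge 6-multiset through its zero-sum
  triples — for every sorted zero-sum triple T the weights lie in {M, 2M} and the table `tab6_M` keyed by the profile gives
  its parity (at the profile or its complement), the parities agreeing at complementary profiles (T₁ ∗ T₂ is Hodge iff the profiles are complementary, Lemma
  `par6`); every σ_{p,i} by enumeration;
* `witness_hodge_M`, `witness_in_H_M`, `witness_par_M` — an explicit Hodge multiset x_M (`xM_M`) with s(x_M) ∈ H_M and
  χ_M(s(x_M)) ODD — hence `witness_notin_M`: s(x_M) ∉ L_M (the span of the odd vectors of ALL blocks; the functional argument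
  `notin_of_parity`), so [H_M : L_M] ≥ 2 — the «≥» half of Theorem A's «= 2»;
* `blocks_ok_M`, `K_eq_M`, `cert_M`, `ker_sub_M` — every s ∈ H_M with χ_M(s) even is an integer combination of the odd vectors
  of listed legitimate level-M blocks (`blocks_M`, each checked a block): a certificate of the shape d·(1 − K̃ᵀ·W̃) = X̃·B̃ on the
  augmented system B̃ = [[BH_M, 0], [χ_M, −2]] (K̃ a ℤ-basis of its kernel, K̃ projected = C₀·G);
* `index_two_M` — hence H_M ⊓ L_M = H_M ⊓ {s : χ_M(s) even} while s(x_M) ∈ H_M has χ_M odd (`witness_not_le_M`): H_M ⊓ L_M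
  is EXACTLY the index-2 sublattice of H_M cut out by χ_M.  With L_M ⊆ H_M (every block is a Hodge multiset — the page's
  Lemma 1 (b)/(d), not formalised here) this is [H_M : L_M] = 2 on the coordinates a < M/2, i.e. Theorem A's index-2 claim at M
  once the coordinate M/2 is taken modulo 2e_{M/2} (the page's l.7 bookkeeping, as in the index-1 and index-2 artefacts).
NOT formalised: L_M ⊆ H_M; claim(·) for the blocks (Shioda 1981 Thm 4.3 / Lefschetz (1,1), Aoki 1987 Thm 2-1 / Thm 1-4);
anything Hodge-theoretic.  The data were found by gen_i2x.py (own enumeration of every block of the level, the mod-2 row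
space of their odd vectors, a sparse χ in its annihilator with χ(x_M) odd, the profile table, and the certificate by a greedy
tracked echelon over the level-M blocks; K̃ = the deposit routine intlin_local.int_kernel's basis).
Nothing here asserts anything about whether the statement of README §1 has been proved elsewhere.
-/

namespace HodgeRepro0.P1.P1LatticeIndexTwoExact
open Matrix

/-- a binary tree of natural numbers (the rows of a matrix as fixed-width decimal literals, or a vector), looked up by the bits
of the index (O(log) kernel steps) -/
inductive R where
  | l : ℕ → R
  | n : R → R → R

/-- the lookup: even indices go left, odd indices right, the index halved (a leaf answers whatever is left of the index) -/
def R.g : R → ℕ → ℕ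
  | .l x, _ => x
  | .n a b, i => if i % 2 = 0 then a.g (i / 2) else b.g (i / 2)

/-- lookup of a key in a chunk (a list of entries 2·key + parity) -/
def findIn : List ℕ → ℕ → Option ℕ
  | [], _ => none
  | x :: xs, k => if x / 2 = k then some (x % 2) else findIn xs k

/-- lookup in a two-level table: chunks in increasing key order, each a list of entries 2·key + parity in increasing order;
the first chunk whose last key is ≥ k is searched (the order is never used for soundness, only what `findC` returns) -/
def findC : List (List ℕ) → ℕ → Option ℕ
  | [], _ => none
  | c :: cs, k => if k ≤ c.getLastD 0 / 2 then findIn c k else findC cs k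

/-- lookup of a key or, failing that, of its complement `co k` (a table stores one of each complementary pair) -/
def find2 (co : ℕ → ℕ) (cs : List (List ℕ)) (k : ℕ) : Option ℕ :=
  match findC cs k with | some e => some e | none => findC cs (co k)

/-- the entries of a table -/
def entriesC (cs : List (List ℕ)) : List ℕ := cs.flatten

/-- the consistency of a table under the complement: a stored key and its stored complement carry the same parity -/
def consistent (co : ℕ → ℕ) (cs : List (List ℕ)) : Bool :=
  (entriesC cs).all fun x => match findC cs (co (x / 2)) with | none => true | some e' => x % 2 == e'

/-- whatever `findIn` returns is an entry of the chunk -/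
theorem findIn_mem : ∀ (c : List ℕ) (k e : ℕ), findIn c k = some e → ∃ x ∈ c, x / 2 = k ∧ x % 2 = e
  | [], k, e, h => by simp [findIn] at h
  | x :: xs, k, e, h => by
    unfold findIn at h
    by_cases hx : x / 2 = k
    · rw [if_pos hx] at h
      simp only [Option.some.injEq] at h
      exact ⟨x, by simp, hx, h⟩
    · rw [if_neg hx] at h
      obtain ⟨y, hy, hy1, hy2⟩ := findIn_mem xs k e h
      exact ⟨y, List.mem_cons_of_mem _ hy, hy1, hy2⟩

/-- whatever `findC` returns is an entry of the table -/
theorem findC_mem : ∀ (cs : List (List ℕ)) (k e : ℕ), findC cs k = some e → ∃ x ∈ entriesC cs, x / 2 = k ∧ x % 2 = e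
  | [], k, e, h => by simp [findC] at h
  | c :: cs, k, e, h => by
    unfold findC at h
    by_cases hc : k ≤ c.getLastD 0 / 2
    · rw [if_pos hc] at h
      obtain ⟨y, hy, hy1, hy2⟩ := findIn_mem c k e h
      exact ⟨y, by simp [entriesC, hy], hy1, hy2⟩
    · rw [if_neg hc] at h
      obtain ⟨y, hy, hy1, hy2⟩ := findC_mem cs k e h
      refine ⟨y, ?_, hy1, hy2⟩
      simp only [entriesC, List.flatten_cons, List.mem_append]
      exact Or.inr hy

/-- THE TABLE LEMMA: if the table is consistent under `co`, two keys that are each other's complement get the same parity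
from `find2` -/
theorem find2_compl (co : ℕ → ℕ) (cs : List (List ℕ)) (hc : consistent co cs = true) (k₁ k₂ e₁ e₂ : ℕ)
    (h12 : co k₁ = k₂) (h21 : co k₂ = k₁) (f1 : find2 co cs k₁ = some e₁) (f2 : find2 co cs k₂ = some e₂) : e₁ = e₂ := by
  unfold find2 at f1 f2
  rw [h12] at f1
  rw [h21] at f2
  simp only [consistent, List.all_eq_true] at hc
  cases hA : findC cs k₁ with
  | some a =>
    rw [hA] at f1 f2
    simp only [Option.some.injEq] at f1 f2
    cases hB : findC cs k₂ with
    | some b =>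
      rw [hB] at f2
      simp only [Option.some.injEq] at f2
      obtain ⟨x, hx, hx1, hx2⟩ := findC_mem cs k₁ a hA
      have := hc x hx
      rw [hx1, h12, hB] at this
      simp only [beq_iff_eq] at this
      omega
    | none =>
      rw [hB] at f2
      simp only [Option.some.injEq] at f2
      omega
  | none =>
    rw [hA] at f1 f2
    cases hB : findC cs k₂ with
    | some b =>
      rw [hB] at f1 f2
      simp only [Option.some.injEq] at f1 f2
      omega
    | none =>
      rw [hB] at f1
      simp at f1

/-- S(u, x) := Σᵢ (u·xᵢ mod mm): Shioda's |u·x| (Sh81-1 (1.3)) is S(u, x)/mm -/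
def S (mm u : ℕ) (x : List ℕ) : ℕ := (x.map (fun a => (u * a) % mm)).sum

/-- S is additive over concatenation -/
theorem S_append (mm u : ℕ) (x y : List ℕ) : S mm u (x ++ y) = S mm u x + S mm u y := by
  simp [S]

/-- the units of ℤ/mm in increasing order -/
def unitsL (mm : ℕ) : List ℕ := (List.range mm).filter (fun t => Nat.gcd t mm = 1)

/-- membership in the unit list -/
theorem mem_unitsL (mm u : ℕ) : u ∈ unitsL mm ↔ u < mm ∧ Nat.gcd u mm = 1 := by
  simp [unitsL]

/-- the Hodge test on a list, the units U given: even length, entries in [1, mm−1], 2·S(u, x) = |x|·mm for every u ∈ U -/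
def isHodge (mm : ℕ) (U : List ℕ) (x : List ℕ) : Bool :=
  x.length % 2 == 0 && x.all (fun a => decide (0 < a) && decide (a < mm)) && U.all (fun u => 2 * S mm u x == x.length * mm)

/-- the weight of a multiset at u: Σ_{a ∈ m} (u·a mod mm) -/
def wt (mm u : ℕ) (m : Multiset ℕ) : ℕ := (m.map (fun a => (u * a) % mm)).sum

/-- a HODGE multiset at level mm (Aoki 1987 p. 385, Shioda's weight): even cardinality, entries in [1, mm−1], and
2·wt(u) = card·mm for every unit u of ℤ/mm -/
def IsHodge (mm : ℕ) (m : Multiset ℕ) : Prop :=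
  Even (Multiset.card m) ∧ (∀ a ∈ m, 0 < a ∧ a < mm) ∧ ∀ u, u < mm → Nat.gcd u mm = 1 → 2 * wt mm u m = Multiset.card m * mm

/-- the weight of a list, as a multiset, is S -/
theorem wt_coe (mm u : ℕ) (l : List ℕ) : wt mm u (l : Multiset ℕ) = S mm u l := by
  simp [wt, S]

/-- the weight is additive -/
theorem wt_add (mm u : ℕ) (m₁ m₂ : Multiset ℕ) : wt mm u (m₁ + m₂) = wt mm u m₁ + wt mm u m₂ := by
  simp [wt]

/-- the list test and the multiset predicate agree -/
theorem isHodge_iff (mm : ℕ) (l : List ℕ) : isHodge mm (unitsL mm) l = true ↔ IsHodge mm (l : Multiset ℕ) := by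
  simp only [isHodge, IsHodge, Bool.and_eq_true, beq_iff_eq, List.all_eq_true, decide_eq_true_eq, mem_unitsL,
    Multiset.coe_card, Multiset.mem_coe, wt_coe, Nat.even_iff]
  constructor
  · rintro ⟨⟨h1, h2⟩, h3⟩
    exact ⟨h1, h2, fun u hu hg => h3 u ⟨hu, hg⟩⟩
  · rintro ⟨h1, h2, h3⟩
    exact ⟨⟨h1, h2⟩, fun u hu => h3 u hu.1 hu.2⟩

/-- the odd vector of a multiset at M on the coordinates a = 0, …, n−1 (the pair {a+1, M−(a+1)}; n = ⌊(M−1)/2⌋, so the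
coordinate M/2 of an even M is not a coordinate): sₐ = mult(a+1) − mult(M−(a+1)) -/
def oddVec {n : ℕ} (M : ℕ) (m : Multiset ℕ) (a : Fin n) : ℤ :=
  (m.count (a.val + 1) : ℤ) - (m.count (M - (a.val + 1)) : ℤ)

/-- the odd vector is additive -/
theorem oddVec_add {n : ℕ} (M : ℕ) (m₁ m₂ : Multiset ℕ) :
    oddVec (n := n) M (m₁ + m₂) = oddVec M m₁ + oddVec M m₂ := by
  funext a
  simp only [oddVec, Multiset.count_add, Pi.add_apply]
  push_cast
  ring

/-- the functional φ_χ(s) = Σₐ χₐ·sₐ, ℤ-linear -/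
def phi {n : ℕ} (chi : Fin n → ℤ) : (Fin n → ℤ) →ₗ[ℤ] ℤ where
  toFun s := ∑ a, chi a * s a
  map_add' s t := by simp only [Pi.add_apply, mul_add, Finset.sum_add_distrib]
  map_smul' c s := by simp only [Pi.smul_apply, smul_eq_mul, RingHom.id_apply, Finset.mul_sum, mul_left_comm]

/-- the functional, unfolded -/
theorem phi_apply {n : ℕ} (chi : Fin n → ℤ) (s : Fin n → ℤ) : phi chi s = ∑ a, chi a * s a := rfl

/-- the 0/1 functional with support `sup` (a list of coordinate indices a, 0 ≤ a < n) -/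
def chiF (n : ℕ) (sup : List ℕ) : Fin n → ℤ := fun a => if a.val ∈ sup then 1 else 0

/-- the odd vector of a list at a natural-number coordinate -/
def oddVecN (M : ℕ) (x : List ℕ) (a : ℕ) : ℤ := (x.count (a + 1) : ℤ) - (x.count (M - (a + 1)) : ℤ)

/-- the parity the kernel computes: Σ_{a ∈ sup} oddVecN M x a mod 2, as 0 or 1 -/
def parL (M : ℕ) (sup : List ℕ) (x : List ℕ) : ℕ := ((sup.map (oddVecN M x)).sum % 2).toNat

/-- a sum over an indicator of a list with a new head -/
theorem sum_indicator_cons {n : ℕ} (v : Fin n → ℤ) (i : ℕ) (L : List ℕ) (hi : i < n) (hL : i ∉ L) :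
    ∑ a : Fin n, (if a.val ∈ i :: L then v a else 0) = v ⟨i, hi⟩ + ∑ a : Fin n, (if a.val ∈ L then v a else 0) := by
  have e : ∀ a : Fin n, (if a.val ∈ i :: L then v a else 0) =
      (if a = ⟨i, hi⟩ then v a else 0) + (if a.val ∈ L then v a else 0) := by
    intro a
    by_cases h1 : a = ⟨i, hi⟩
    · subst h1
      simp [hL]
    · have h2 : a.val ≠ i := fun h => h1 (Fin.ext h)
      simp [h2, h1]
  simp only [e, Finset.sum_add_distrib, Finset.sum_ite_eq', Finset.mem_univ, if_true]

/-- the functional with support `sup` is the sum over the support -/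
theorem phi_chiF {n : ℕ} (sup : List ℕ) (hnd : sup.Nodup) (hlt : ∀ i ∈ sup, i < n) (v : Fin n → ℤ) :
    phi (chiF n sup) v = (sup.map (fun i => if h : i < n then v ⟨i, h⟩ else 0)).sum := by
  induction sup with
  | nil => simp [phi_apply, chiF]
  | cons i L ih =>
    rw [List.nodup_cons] at hnd
    have hi : i < n := hlt i (by simp)
    simp only [List.map_cons, List.sum_cons, dif_pos hi]
    rw [← ih hnd.2 (fun j hj => hlt j (List.mem_cons_of_mem _ hj))]
    simp only [phi_apply, chiF]
    have e : ∀ (T : List ℕ) (a : Fin n), (if a.val ∈ T then (1 : ℤ) else 0) * v a = if a.val ∈ T then v a else 0 := by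
      intro T a
      split_ifs <;> simp
    simp only [e]
    exact sum_indicator_cons v i L hi hnd.1

/-- THE PARITY BRIDGE: parL is φ_χ(oddVec) mod 2 -/
theorem parL_eq {n : ℕ} (M : ℕ) (sup : List ℕ) (hnd : sup.Nodup) (hlt : ∀ i ∈ sup, i < n) (x : List ℕ) :
    (parL M sup x : ℤ) = phi (chiF n sup) (oddVec M (x : Multiset ℕ)) % 2 := by
  rw [phi_chiF sup hnd hlt]
  have e : (sup.map (fun i => if h : i < n then oddVec M (x : Multiset ℕ) ⟨i, h⟩ else 0)) = sup.map (oddVecN M x) := by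
    apply List.map_congr_left
    intro i hi
    rw [dif_pos (hlt i hi)]
    simp [oddVec, oddVecN, Multiset.coe_count]
  rw [e]
  exact Int.toNat_of_nonneg (Int.emod_nonneg _ (by norm_num))

/-- Aoki's standard element σ_{p,i} at level mm: {i + j·(mm/p) : j < p} ∪ {−p·i} -/
def sigma (mm p i : ℕ) : List ℕ :=
  (List.range p).map (fun j => (i + j * (mm / p)) % mm) ++ [(mm - (p * i) % mm) % mm]

/-- THE BLOCK SET of the degree M (proofs/P1-FermatLatticeClosure-v1.2.md Lemma 1 (b), with rev-2 (g15)'s P-3): a Hodge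
4-multiset of ℤ/M; a Hodge 6-multiset of ℤ/M that is the sum of two zero-sum triples; Aoki's standard element σ_{p,i}
for an odd prime p ∣ M and 1 ≤ i < M with (M/p)/gcd(i, M/p) > 2 — the full p-standard set of level M, i.e. the σ_{p,i}
of level M with gcd(i, M/p) = 1 together with the pull-backs (i = k·i′, k = M/m′) of the σ_{p,i′} of every level m′ ∣ M.
The pull-backs and unit translates of Hodge 4- and split Hodge 6-multisets of the levels m′ ∣ M are such multisets of
ℤ/M themselves and t·σ_{p,i} = σ_{p,t·i}, so every block of the page's L_M is in this set. -/
def IsBlock (M : ℕ) (m : Multiset ℕ) : Prop :=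
  (Multiset.card m = 4 ∧ IsHodge M m) ∨
  (∃ T₁ T₂ : List ℕ, m = ((T₁ ++ T₂ : List ℕ) : Multiset ℕ) ∧ T₁.length = 3 ∧ T₂.length = 3 ∧
    T₁.sum % M = 0 ∧ T₂.sum % M = 0 ∧ IsHodge M m) ∨
  (∃ p i : ℕ, Nat.Prime p ∧ p % 2 = 1 ∧ M % p = 0 ∧ 0 < i ∧ i < M ∧ 2 < (M / p) / Nat.gcd i (M / p) ∧
    m = ((sigma M p i : List ℕ) : Multiset ℕ))

/-- the profile of a list: the bits [M < S(u, T)] over the units, folded into one natural number -/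
def prof (M : ℕ) : List ℕ → List ℕ → ℕ
  | [], _ => 0
  | u :: U, T => 2 * prof M U T + (if M < S M u T then 1 else 0)

/-- the profile of a zero-sum triple, with the condition S(u, T) ∈ {M, 2M} checked on the way (none if it fails) -/
def prof3 (M : ℕ) : List ℕ → List ℕ → Option ℕ
  | [], _ => some 0
  | u :: U, T => match prof3 M U T with
    | none => none
    | some p => if S M u T = M then some (2 * p) else if S M u T = 2 * M then some (2 * p + 1) else none

/-- the profile of a pair, with the condition S(u, T) ≢ 0 (mod M) checked on the way (none if it fails) -/
def prof2 (M : ℕ) : List ℕ → List ℕ → Option ℕ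
  | [], _ => some 0
  | u :: U, T => match prof2 M U T with
    | none => none
    | some p => if S M u T % M = 0 then none else some (2 * p + (if M < S M u T then 1 else 0))

/-- the complementary key of a pair key M·profile + (sum mod M): M·(complementary profile) + (M − sum mod M) -/
def cokeyP (M : ℕ) (U : List ℕ) (k : ℕ) : ℕ := M * (2 ^ U.length - 1 - k / M) + (M - k % M)

/-- the complementary profile -/
def cokey6 (U : List ℕ) (k : ℕ) : ℕ := 2 ^ U.length - 1 - k

/-- THE PAIR CHECK for the first entry a (the 4-multisets; U a list of units): for every b ≥ a with a + b ≢ 0 (mod M) and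
a, b ∈ [1, M−1], S(u, [a, b]) ≢ 0 (mod M) for every u ∈ U and the table gives the parity at the key M·profile + ((a + b)
mod M) or at the complementary key -/
def checkPa (M : ℕ) (U : List ℕ) (sup : List ℕ) (cs : List (List ℕ)) (a : ℕ) : Bool :=
  a == 0 || (List.range M).all fun b => b < a || (a + b) % M == 0 ||
    match prof2 M U [a, b] with
    | none => false
    | some P => find2 (cokeyP M U) cs (M * P + (a + b) % M) == some (parL M sup [a, b])

/-- THE ZERO-SUM-TRIPLE CHECK for the first entry a (the split 6-multisets): for every sorted zero-sum triple [a, b, c] ⊂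
[1, M−1], S(u, T) ∈ {M, 2M} for every u ∈ U and the table gives the parity at the profile or at its complement -/
def check6a (M : ℕ) (U : List ℕ) (sup : List ℕ) (cs : List (List ℕ)) (a : ℕ) : Bool :=
  a == 0 || (List.range M).all fun b => b < a ||
    (let c := (M - (a + b) % M) % M
     c == 0 || c < b ||
       match prof3 M U [a, b, c] with
       | none => false
       | some P => find2 (cokey6 U) cs P == some (parL M sup [a, b, c]))

/-- the consistency of the part `sub` of a table under the complement: a stored key whose complement is stored carries the
same parity -/
def consistentOn (co : ℕ → ℕ) (cs : List (List ℕ)) (sub : List (List ℕ)) : Bool :=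
  (entriesC sub).all fun x => match findC cs (co (x / 2)) with | none => true | some e' => x % 2 == e'

/-- consistency over a concatenation of parts -/
theorem consistentOn_append (co : ℕ → ℕ) (cs s t : List (List ℕ)) :
    consistentOn co cs (s ++ t) = (consistentOn co cs s && consistentOn co cs t) := by
  simp [consistentOn, entriesC, List.flatten_append, List.all_append]

/-- consistency is consistency over the whole table -/
theorem consistent_eq (co : ℕ → ℕ) (cs : List (List ℕ)) : consistent co cs = consistentOn co cs cs := rfl

/-- THE PAIR CHECK (all first entries) with the consistency of the table -/
def checkP (M : ℕ) (U : List ℕ) (sup : List ℕ) (cs : List (List ℕ)) : Bool :=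
  (List.range M).all (checkPa M U sup cs) && consistent (cokeyP M U) cs

/-- THE ZERO-SUM-TRIPLE CHECK (all first entries) with the consistency of the table -/
def check6 (M : ℕ) (U : List ℕ) (sup : List ℕ) (cs : List (List ℕ)) : Bool :=
  (List.range M).all (check6a M U sup cs) && consistent (cokey6 U) cs

/-- THE σ CHECK: every σ_{p,i} of the block set has even parity -/
def checkS (M : ℕ) (sup : List ℕ) : Bool :=
  (List.range (M + 1)).all fun p => !(decide (Nat.Prime p) && p % 2 == 1 && M % p == 0) ||
    (List.range M).all fun i => i == 0 || !(decide (2 < (M / p) / Nat.gcd i (M / p))) || parL M sup (sigma M p i) == 0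

/-- two adjacent ranges (the bounds given as separate literals, so that no numeral arithmetic is left to unification) -/
theorem range'_all_cat (f : ℕ → Bool) (lo l₁ l₂ l lo₂ : ℕ) (hl : l₁ + l₂ = l) (hlo : lo + l₁ = lo₂)
    (h1 : (List.range' lo l₁).all f = true) (h2 : (List.range' lo₂ l₂).all f = true) :
    (List.range' lo l).all f = true := by
  subst hl hlo
  rw [List.all_eq_true] at *
  intro a ha
  rw [List.mem_range'_1] at ha
  by_cases h : a < lo + l₁
  · exact h1 a (List.mem_range'_1.mpr ⟨ha.1, h⟩)
  · exact h2 a (List.mem_range'_1.mpr ⟨by omega, by omega⟩)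

/-- `List.range M` is `List.range' 0 M` -/
theorem range_all_of_range' (f : ℕ → Bool) (M : ℕ) (h : (List.range' 0 M).all f = true) : (List.range M).all f = true := by
  rw [List.range_eq_range']
  exact h

end HodgeRepro0.P1.P1LatticeIndexTwoExact
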